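import Literature.Analysis.UnboundedOperators.UnitaryRepSpectralMeasure
import Mathlib.Analysis.Calculus.Deriv.Slope
import HarnessLib

/-!
# Moments of spectral measures from bounds on iterated differences

Topic `Analysis/UnboundedOperators`; namespace `Literature.Analysis.UnboundedOperators`. Definitions
with bodies and theorems (no named fact), continuing `UnitaryRepSpectralMeasure` (spectral measures
`μ_v` of a unitary representation `U` of the additive group of a finite-dimensional real vector
space `V`, `⟪v, U_x v⟫ = ∫ exp(i B(ξ, x)) dμ_v(ξ)`). Without unbounded operators (no generators, no
domains) we PROVE the "moment" inequalities that control polynomial weights against `μ_v` by norms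
of difference quotients of the orbit `x ↦ U_x v` (Stone (1932); Riesz–Sz.-Nagy (1955), §137;
Folland (1995), Thm. 4.44):

* `UnitaryRep.diff x v = U_x v - v`, `UnitaryRep.iterDiff x N v = (U_x - 1)^N v`;
* `spectralMeasure_diff` — **the spectral measure of a difference**:
  `μ_{U_x w - w} = |e^{iB(ξ,x)} - 1|² · μ_w` (the matrix coefficient of `U_x w - w` is
  `2⟪w, U_y w⟫ - ⟪w, U_{y-x} w⟫ - ⟪w, U_{y+x} w⟫` and `|e^{it} - 1|² = 2 - e^{-it} - e^{it}`;
  uniqueness of the spectral measure);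
* `spectralMeasure_iterDiff`, `lintegral_diffDensity_pow_eq` —
  `∫ |e^{iB(ξ,x)} - 1|^{2N} dμ_v(ξ) = ‖(U_x - 1)^N v‖²`;
* `lintegral_pow_abs_bilin_le_of_norm_iterDiff_le` — **moments from difference bounds** (Fatou along
  `t ↓ 0`, `|e^{itθ} - 1| / t → |θ|`): if `‖(U_{tb} - 1)^N v‖ ≤ C t^N` for small `t > 0` then
  `∫ |B(ξ, b)|^{2N} dμ_v(ξ) ≤ C²`.

In the application (`NumberTheory/Automorphic`, Kirillov `L²`-bound) `v = S_θ f` is a smoothed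
automorphic vector, `U` the archimedean unipotent line of `GL_2`, and
`‖(U_{tb} - 1)^N S_θ f‖ ≤ t^N ‖S_{θ_{(bE)^N}} f‖` by the `L²`-differentiability of the orbit.

## References

* M. H. Stone, *On one-parameter unitary groups in Hilbert space*, Ann. of Math. 33 (1932)
  [Stone1932].
* G. B. Folland, *A course in abstract harmonic analysis* (1995), §4.4, Thm. 4.44 [Folland1995].
-/

noncomputable section

open scoped ComplexConjugate InnerProductSpace ENNReal NNReal Topology
open MeasureTheory Complex Filter

namespace Literature.Analysis.UnboundedOperators

namespace UnitaryRep

section Differences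

variable {V : Type*} [NormedAddCommGroup V]
  {H : Type*} [NormedAddCommGroup H] [InnerProductSpace ℂ H] [CompleteSpace H]
  (U : UnitaryRep (Multiplicative V) H)

/-! ### Differences -/

/-- The difference `Δ_x v = U_x v - v`. [folklore] -/
def diff (x : V) (v : H) : H := U (Multiplicative.ofAdd x) v - v

/-- The iterated difference `Δ_x^N v = (U_x - 1)^N v`. [folklore] -/
def iterDiff (x : V) : ℕ → H → H
  | 0, v => v
  | N + 1, v => U.diff x (iterDiff x N v)

/-- Unfolding of `diff`. [folklore] -/
theorem diff_apply (x : V) (v : H) : U.diff x v = U (Multiplicative.ofAdd x) v - v := rfl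

/-- `Δ_x^0 v = v`. [folklore] -/
@[simp]
theorem iterDiff_zero (x : V) (v : H) : U.iterDiff x 0 v = v := rfl

/-- `Δ_x^{N+1} v = Δ_x (Δ_x^N v)`. [folklore] -/
theorem iterDiff_succ (x : V) (N : ℕ) (v : H) : U.iterDiff x (N + 1) v = U.diff x (U.iterDiff x N v) := rfl

/-- `Δ_x^{N+1} v = Δ_x^N (Δ_x v)` (the difference operators commute). [folklore] -/
theorem iterDiff_succ' (x : V) : ∀ (N : ℕ) (v : H), U.iterDiff x (N + 1) v = U.iterDiff x N (U.diff x v)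
  | 0, _ => rfl
  | N + 1, v => by rw [iterDiff_succ, iterDiff_succ' x N v, iterDiff_succ]

/-- `Δ_x` is additive. [folklore] -/
theorem diff_add (x : V) (v w : H) : U.diff x (v + w) = U.diff x v + U.diff x w := by
  simp only [diff_apply, map_add]; abel

/-- `Δ_x` is homogeneous. [folklore] -/
theorem diff_smul (x : V) (c : ℂ) (v : H) : U.diff x (c • v) = c • U.diff x v := by
  simp only [diff_apply, map_smul, smul_sub]

/-- `Δ_x` commutes with `U_y`. [folklore] -/
theorem diff_map (x y : V) (v : H) : U.diff x (U (Multiplicative.ofAdd y) v) = U (Multiplicative.ofAdd y) (U.diff x v) := by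
  simp only [diff_apply, map_sub, ← U.map_ofAdd_add_apply, add_comm]

/-- `Δ_x^N` commutes with `U_y`. [folklore] -/
theorem iterDiff_map (x y : V) : ∀ (N : ℕ) (v : H),
    U.iterDiff x N (U (Multiplicative.ofAdd y) v) = U (Multiplicative.ofAdd y) (U.iterDiff x N v)
  | 0, _ => rfl
  | N + 1, v => by rw [iterDiff_succ, iterDiff_succ, iterDiff_map x y N v, diff_map]

end Differences

section Moments

variable {V : Type*} [NormedAddCommGroup V] [NormedSpace ℝ V] [FiniteDimensional ℝ V]
  [MeasurableSpace V] [BorelSpace V]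
  {H : Type*} [NormedAddCommGroup H] [InnerProductSpace ℂ H] [CompleteSpace H]
  (U : UnitaryRep (Multiplicative V) H) (B : LinearMap.BilinForm ℝ V)

/-! ### Spectral measures of differences -/

/-- The density `d_x(ξ) = |e^{iB(ξ,x)} - 1|²` (in `ℝ≥0`). [folklore] -/
def diffDensity (x ξ : V) : ℝ≥0 := ‖cexp ((B ξ x : ℝ) * I) - 1‖₊ ^ 2

omit [MeasurableSpace V] [BorelSpace V] in
/-- The density is continuous. [folklore] -/
theorem continuous_diffDensity (x : V) : Continuous (diffDensity B x) :=
  ((((continuous_cexp_bilin_uncurry B).comp (continuous_id.prodMk continuous_const)).sub continuous_const).nnnorm).pow 2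

/-- The density is measurable. [folklore] -/
theorem measurable_diffDensity (x : V) : Measurable (diffDensity B x) := (continuous_diffDensity B x).measurable

omit [FiniteDimensional ℝ V] [MeasurableSpace V] [BorelSpace V] in
/-- **`|e^{it} - 1|² = 2 - e^{-it} - e^{it}`** on the characters: as complex numbers,
`d_x(ξ) = 2 - e^{iB(ξ,-x)} - e^{iB(ξ,x)}`. [folklore] -/
theorem coe_diffDensity_eq (x ξ : V) :
    ((diffDensity B x ξ : ℝ) : ℂ) = 2 - cexp ((B ξ (-x) : ℝ) * I) - cexp ((B ξ x : ℝ) * I) := by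
  rw [diffDensity, NNReal.coe_pow, coe_nnnorm, ← Complex.normSq_eq_norm_sq, Complex.normSq_eq_conj_mul_self,
    map_sub, map_one, ← Complex.exp_conj, map_mul, Complex.conj_ofReal, Complex.conj_I, map_neg, Complex.ofReal_neg, mul_neg, neg_mul]
  have h : cexp (-(((B ξ x : ℝ) : ℂ) * I)) * cexp (((B ξ x : ℝ) : ℂ) * I) = 1 := by
    rw [← Complex.exp_add, neg_add_cancel, Complex.exp_zero]
  linear_combination h

omit [NormedSpace ℝ V] [FiniteDimensional ℝ V] [MeasurableSpace V] [BorelSpace V] in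
/-- The matrix coefficient of a difference:
`⟪Δ_x w, U_y Δ_x w⟫ = 2⟪w, U_y w⟫ - ⟪w, U_{y-x} w⟫ - ⟪w, U_{y+x} w⟫`. [folklore] -/
theorem inner_diff_map_diff (x y : V) (w : H) :
    ⟪U.diff x w, U (Multiplicative.ofAdd y) (U.diff x w)⟫_ℂ =
      2 * ⟪w, U (Multiplicative.ofAdd y) w⟫_ℂ - ⟪w, U (Multiplicative.ofAdd (y - x)) w⟫_ℂ -
        ⟪w, U (Multiplicative.ofAdd (y + x)) w⟫_ℂ := by
  simp only [diff_apply, map_sub, inner_sub_left, inner_sub_right, ← U.map_ofAdd_add_apply]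
  rw [U.inner_map_ofAdd_map_ofAdd_eq, U.inner_map_ofAdd_map_ofAdd_eq, add_sub_cancel_right]
  have h0 : ⟪w, U (Multiplicative.ofAdd y) w⟫_ℂ = ⟪w, U (Multiplicative.ofAdd (y - 0)) w⟫_ℂ := by rw [sub_zero]
  ring

/-- **The spectral measure of a difference**: `μ_{U_x w - w} = |e^{iB(ξ,x)} - 1|² · μ_w`.
[cite: Folland1995, Thm. 4.44] -/
theorem spectralMeasure_diff (hB : B.Nondegenerate) (x : V) (w : H) :
    U.spectralMeasure B hB (U.diff x w) =
      (U.spectralMeasure B hB w).withDensity fun ξ => (diffDensity B x ξ : ℝ≥0∞) := by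
  haveI : IsFiniteMeasure ((U.spectralMeasure B hB w).withDensity fun ξ => (diffDensity B x ξ : ℝ≥0∞)) := by
    refine isFiniteMeasure_withDensity ?_
    refine ne_of_lt ((lintegral_mono (g := fun _ => (4 : ℝ≥0∞)) fun ξ => ?_).trans_lt ?_)
    · have h : (diffDensity B x ξ : ℝ≥0∞) ≤ ((2 : ℝ≥0) ^ 2 : ℝ≥0) := by
        refine ENNReal.coe_le_coe.2 (pow_le_pow_left₀ (by positivity) ?_ 2)
        calc ‖cexp ((B ξ x : ℝ) * I) - 1‖₊ ≤ ‖cexp ((B ξ x : ℝ) * I)‖₊ + ‖(1 : ℂ)‖₊ := nnnorm_sub_le _ _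
          _ = 2 := by rw [nnnorm_one, ← NNReal.coe_inj, NNReal.coe_add, coe_nnnorm, norm_cexp_bilin_mul_I]; norm_num
      exact h.trans (by norm_num)
    · rw [lintegral_const]; exact ENNReal.mul_lt_top (by norm_num) (measure_lt_top _ _)
  refine U.spectralMeasure_unique B hB _ fun y => ?_
  rw [inner_diff_map_diff, U.inner_map_eq_integral_spectralMeasure B hB, U.inner_map_eq_integral_spectralMeasure B hB,
    U.inner_map_eq_integral_spectralMeasure B hB,
    integral_withDensity_eq_integral_smul (measurable_diffDensity B x)]
  have hI := fun z => integrable_cexp_bilin B (U.spectralMeasure B hB w) z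
  have hpt : ∀ ξ : V, (diffDensity B x ξ) • cexp ((B ξ y : ℝ) * I) =
      2 * cexp ((B ξ y : ℝ) * I) - cexp ((B ξ (y - x) : ℝ) * I) - cexp ((B ξ (y + x) : ℝ) * I) := by
    intro ξ
    rw [NNReal.smul_def, Complex.real_smul, coe_diffDensity_eq, map_sub, map_add, map_neg]
    push_cast
    simp only [sub_mul, add_mul, neg_mul, Complex.exp_add, Complex.exp_sub, Complex.exp_neg]
    have hne : cexp ((B ξ x : ℝ) * I) ≠ 0 := Complex.exp_ne_zero _
    field_simp
  have hsplit : ∫ ξ, (2 * cexp ((B ξ y : ℝ) * I) - cexp ((B ξ (y - x) : ℝ) * I) - cexp ((B ξ (y + x) : ℝ) * I)) ∂(U.spectralMeasure B hB w) =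
      2 * ∫ ξ, cexp ((B ξ y : ℝ) * I) ∂(U.spectralMeasure B hB w) - ∫ ξ, cexp ((B ξ (y - x) : ℝ) * I) ∂(U.spectralMeasure B hB w) -
        ∫ ξ, cexp ((B ξ (y + x) : ℝ) * I) ∂(U.spectralMeasure B hB w) := by
    rw [integral_sub, integral_sub, integral_const_mul]
    · exact (hI y).const_mul 2
    · exact hI (y - x)
    · exact ((hI y).const_mul 2).sub (hI (y - x))
    · exact hI (y + x)
  rw [integral_congr_ae (ae_of_all _ hpt), hsplit]

/-- **The spectral measure of an iterated difference**: `μ_{(U_x-1)^N v} = |e^{iB(ξ,x)} - 1|^{2N} · μ_v`.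
[folklore] -/
theorem spectralMeasure_iterDiff (hB : B.Nondegenerate) (x : V) :
    ∀ (N : ℕ) (v : H), U.spectralMeasure B hB (U.iterDiff x N v) =
      (U.spectralMeasure B hB v).withDensity fun ξ => (diffDensity B x ξ : ℝ≥0∞) ^ N
  | 0, v => by simp [iterDiff]
  | N + 1, v => by
    rw [iterDiff_succ, U.spectralMeasure_diff B hB, spectralMeasure_iterDiff hB x N v,
      ← withDensity_mul _ ((measurable_coe_nnreal_ennreal_iff.2 (measurable_diffDensity B x)).pow_const N)
        (measurable_coe_nnreal_ennreal_iff.2 (measurable_diffDensity B x))]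
    refine congrArg _ (funext fun ξ => ?_)
    simp only [Pi.mul_apply, pow_succ, mul_comm]

/-- **Moments of order `N` in closed form**: `∫ |e^{iB(ξ,x)} - 1|^{2N} dμ_v(ξ) = ‖(U_x - 1)^N v‖²`.
[cite: Folland1995, Thm. 4.44] -/
theorem lintegral_diffDensity_pow_eq (hB : B.Nondegenerate) (x : V) (N : ℕ) (v : H) :
    ∫⁻ ξ, (diffDensity B x ξ : ℝ≥0∞) ^ N ∂(U.spectralMeasure B hB v) = ENNReal.ofReal (‖U.iterDiff x N v‖ ^ 2) := by
  rw [← U.spectralMeasure_univ B hB (U.iterDiff x N v), U.spectralMeasure_iterDiff B hB x N v, withDensity_apply _ MeasurableSet.univ,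
    Measure.restrict_univ]

/-! ### Moments from difference bounds -/

omit [FiniteDimensional ℝ V] [MeasurableSpace V] [BorelSpace V] in
/-- **`|e^{itθ} - 1| / t → |θ|` as `t → 0`, `t ≠ 0`** (the derivative of `t ↦ e^{itθ}` at `0`). [folklore] -/
theorem tendsto_norm_cexp_sub_one_div (θ : ℝ) :
    Tendsto (fun t : ℝ => ‖cexp ((t * θ : ℝ) * I) - 1‖ / |t|) (𝓝[≠] 0) (𝓝 |θ|) := by
  have hd : HasDerivAt (fun t : ℝ => cexp ((t * θ : ℝ) * I)) ((θ : ℂ) * I) 0 := by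
    have h1 : HasDerivAt (fun t : ℝ => ((t * θ : ℝ) : ℂ)) (θ : ℂ) 0 := by
      simpa using ((hasDerivAt_id (0 : ℝ)).mul_const θ).ofReal_comp
    simpa using (h1.mul_const I).cexp
  have ht := hasDerivAt_iff_tendsto_slope.1 hd
  have hnorm := ht.norm
  rw [norm_mul, Complex.norm_I, mul_one, Complex.norm_real, Real.norm_eq_abs] at hnorm
  refine hnorm.congr' ?_
  filter_upwards [self_mem_nhdsWithin] with t ht0
  rw [slope_def_module, norm_smul, sub_zero, norm_inv, Real.norm_eq_abs, div_eq_inv_mul]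
  simp

omit [FiniteDimensional ℝ V] [MeasurableSpace V] [BorelSpace V] in
/-- The normalised densities `(|e^{itB(ξ,b)} - 1|² / t²)^N` converge to `|B(ξ, b)|^{2N}` along any
sequence `t_n → 0`, `t_n > 0`. [folklore] -/
theorem tendsto_diffDensity_div_pow {t : ℕ → ℝ} (ht0 : ∀ n, 0 < t n) (ht : Tendsto t atTop (𝓝 0)) (b ξ : V) (N : ℕ) :
    Tendsto (fun n => ((diffDensity B (t n • b) ξ : ℝ) / t n ^ 2) ^ N) atTop (𝓝 (|B ξ b| ^ (2 * N))) := by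
  have hseq : Tendsto t atTop (𝓝[≠] 0) :=
    tendsto_nhdsWithin_iff.2 ⟨ht, Eventually.of_forall fun n => (ht0 n).ne'⟩
  have h := ((tendsto_norm_cexp_sub_one_div (B ξ b)).comp hseq).pow (2 * N)
  refine h.congr fun n => ?_
  simp only [Function.comp_apply, diffDensity, NNReal.coe_pow, coe_nnnorm, map_smul, smul_eq_mul]
  rw [pow_mul, div_pow, sq_abs]

/-- **Moments from difference bounds**: if `‖(U_{tb} - 1)^N v‖ ≤ C t^N` for `0 < t < δ`, then
`∫ |B(ξ, b)|^{2N} dμ_v(ξ) ≤ C²` (Fatou along `t ↓ 0`). [cite: Folland1995, Thm. 4.44] -/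
theorem lintegral_pow_abs_bilin_le_of_norm_iterDiff_le (hB : B.Nondegenerate) (v : H) (b : V) (N : ℕ) {C δ : ℝ} (hδ : 0 < δ)
    (hC : ∀ t : ℝ, 0 < t → t < δ → ‖U.iterDiff (t • b) N v‖ ≤ C * t ^ N) :
    ∫⁻ ξ, ENNReal.ofReal (|B ξ b| ^ (2 * N)) ∂(U.spectralMeasure B hB v) ≤ ENNReal.ofReal (C ^ 2) := by
  -- the sequence `t_n = δ / (n + 2)` in `(0, δ)`
  set t : ℕ → ℝ := fun n => δ / (n + 2) with htdef
  have ht0 : ∀ n, 0 < t n := fun n => div_pos hδ (by positivity)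
  have htδ : ∀ n, t n < δ := fun n => by
    rw [htdef]; exact div_lt_self hδ (by norm_cast; omega)
  have htend : Tendsto t atTop (𝓝 0) := by
    have h1 : Tendsto (fun n : ℕ => (n : ℝ) + 2) atTop atTop := tendsto_natCast_atTop_atTop.atTop_add tendsto_const_nhds
    simpa [htdef] using tendsto_const_nhds.div_atTop h1
  -- the normalised densities
  set g : ℕ → V → ℝ≥0∞ := fun n ξ => ENNReal.ofReal (((diffDensity B (t n • b) ξ : ℝ) / t n ^ 2) ^ N) with hgdef
  have hgm : ∀ n, Measurable (g n) := fun n =>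
    ((((continuous_diffDensity B (t n • b)).measurable.coe_nnreal_real).div_const _).pow_const _).ennreal_ofReal
  have hlim : ∀ ξ, liminf (fun n => g n ξ) atTop = ENNReal.ofReal (|B ξ b| ^ (2 * N)) := fun ξ =>
    ((ENNReal.tendsto_ofReal (tendsto_diffDensity_div_pow B ht0 htend b ξ N))).liminf_eq
  -- each integral is `‖Δ^N v‖² / t^{2N} ≤ C²`
  have hint : ∀ n, ∫⁻ ξ, g n ξ ∂(U.spectralMeasure B hB v) ≤ ENNReal.ofReal (C ^ 2) := by
    intro n
    have htn := ht0 n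
    have hg' : ∀ ξ, g n ξ = (diffDensity B (t n • b) ξ : ℝ≥0∞) ^ N * ENNReal.ofReal ((t n ^ 2)⁻¹ ^ N) := by
      intro ξ
      rw [hgdef]
      simp only []
      rw [div_eq_mul_inv, mul_pow, ENNReal.ofReal_mul (pow_nonneg (NNReal.coe_nonneg _) _), ENNReal.ofReal_pow (NNReal.coe_nonneg _),
        ENNReal.ofReal_coe_nnreal]
    simp_rw [hg']
    rw [lintegral_mul_const _ ((measurable_coe_nnreal_ennreal_iff.2 (measurable_diffDensity B _)).pow_const N),
      U.lintegral_diffDensity_pow_eq B hB, ← ENNReal.ofReal_mul (sq_nonneg _)]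
    refine ENNReal.ofReal_le_ofReal ?_
    have hCt := hC (t n) htn (htδ n)
    calc ‖U.iterDiff (t n • b) N v‖ ^ 2 * (t n ^ 2)⁻¹ ^ N ≤ (C * t n ^ N) ^ 2 * (t n ^ 2)⁻¹ ^ N := by
          gcongr
      _ = C ^ 2 := by
          rw [mul_pow, ← pow_mul, inv_pow, ← pow_mul, mul_comm 2 N, mul_assoc, mul_inv_cancel₀ (pow_ne_zero _ htn.ne'), mul_one]
  calc ∫⁻ ξ, ENNReal.ofReal (|B ξ b| ^ (2 * N)) ∂(U.spectralMeasure B hB v)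
      = ∫⁻ ξ, liminf (fun n => g n ξ) atTop ∂(U.spectralMeasure B hB v) := lintegral_congr fun ξ => (hlim ξ).symm
    _ ≤ liminf (fun n => ∫⁻ ξ, g n ξ ∂(U.spectralMeasure B hB v)) atTop := lintegral_liminf_le hgm
    _ ≤ ENNReal.ofReal (C ^ 2) := Filter.liminf_le_of_frequently_le' (Filter.Eventually.of_forall hint).frequently

end Moments

end UnitaryRep

end Literature.Analysis.UnboundedOperators
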